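import Summits.BirchSwinnertonDyer.BirchSwinnertonDyer.Theorems.Rank1ResidualJetCarrierDepthKernel
import HarnessLib

/-!
# T1 JET (cell `bsd-jet`), carrier `p` (buckets B-mult K3 and B-add K4) and the LEVEL FORMS of all three
# buckets on the DEPTH line — `BSD(E,p)` ⟸ {Poitou–Tate for Selmer structures, F1, Gross 3.7 (2), GZK
# [, modularity]} and the per-row depth datum; NO Kolyvagin theorem, NO index, NO finiteness of anything

HONEST FRAMING (programme file `BSD-LIT2PART-PROGRAMME-v1.md` §HONESTY, verbatim): «no tranche here
proves BSD; ARM L moves the LITERAL column of an r ≤ 1 census into the kernel-proved-modulo-named-print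
column; ARM P changes what «named print» is worth.» THEOREMS ONLY (seat `bsd-jet-pv-1`, session g10;
`--supports stmt-BirchSwinnertonDyer-14418`, helper); nothing is booked, 0 classes move (road K is
DOCUMENTARY; bookings are referee A's). Nothing about any particular curve is asserted.

WHAT. Sibling of `Rank1ResidualJetCarrierDepthKernel` (grammar (III), the DEPTH line: per-row datum
`(t ≤ ord_p c, hdepth : ¬ ∃ Q ∈ E(K), p^{t+1} • Q = P)` in place of Kolyvagin's theorem (grammar (I)) or the
index-finiteness datum (grammar (II))), for the carrier `p` itself and for the register's level forms:
* §1 carrier `p` MULTIPLICATIVE (K3): `bsdp_of_carrierMultCertificate_of_depth` (binders `hJ` K3, `h44`, `hF1`,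
  `hrec`, `hD36`, `hGZK`) and `…_of_swapLiterature_of_depth_of_surj` ⟸ NAMED PRINT ONLY (the tower from
  `ρ̄_{E,p}` onto on the Tate line, `forall_hasSurjectiveModNGaloisRep_pow_of_multiplicative_of_surj`);
* §2 carrier `p` ADDITIVE (K4): `bsdp_of_carrierAddCertificate_of_depth` and `…_of_swapLiterature_of_depth`
  (the tower stays a binder: mod-9 Frobenius certificate at `p = 3`, Serre at `p ≥ 5`);
* §3 LEVEL FORMS (Heegner datum at any stated level `N`; `N = N_E` by Carayol from modularity
  `exists_isNewformOf`): `bsdp_of_carrier{Ne[_of_five_le],Mult_of_surj,Add}Certificate_level_of_swapLiterature_of_depth`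
  and the bucket-A WITNESS level form `…Ne…_level_of_swapLiterature_of_witness` (`Q₀`, `p^t • Q₀ = P`,
  `Q₀ ∉ p·E(K)`) = the booked row grammar with `hKo` replaced by the depth datum.
DISPLAYED named print of every `_of_swapLiterature` door: {`poitouTate_selmerStructure_duality_conj` (∀ K),
`Gross1991_heegnerPoint_sub_ratTorsion_mem_E0`, `GrossLMS1991.prop37_2_frobeniusCongruence`,
`rank_eq_analyticRank_of_analyticRank_le_one`} (+ `exists_isNewformOf` in the level forms) — and nothing else.
References: [cite: Jetchev2008, Thm. 1.4, Cor. 1.5 (p. 812)] [cite: McCallumLMS1991, §5 Lemma 5.1, Cor. 5.6]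
[cite: GrossLMS1991, Prop. 2.1, §10] [cite: Wuthrich2014, Lemma 20 (p. 399)] [cite: DiamondShurman2005,
Thm. 8.8.1] [cite: CasselsFrohlichANT1967, Ch. VII §11]. Design: no definitions; `K : Type`.
Axioms: `propext`, `Classical.choice`, `Quot.sound`.
-/

set_option autoImplicit false

noncomputable section

open scoped Classical

open WeierstrassCurve Literature.NumberTheory.EllipticCurves
  Literature.NumberTheory.EllipticCurves.ModularForms
  Literature.NumberTheory.EllipticCurves.Rank1Residual
  Literature.NumberTheory.GaloisCohomology
  Summit.BirchSwinnertonDyer.Rank1Residual Summit.BirchSwinnertonDyer.Rank1Residual.X11b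

namespace Summit.BirchSwinnertonDyer.Rank1Residual.JET

/-! ### §1 Carrier `p` MULTIPLICATIVE (K3) on the depth line -/

/-- **`BSD(E,p)` from the bucket-B (multiplicative) certificate on the DEPTH line.** `p` odd multiplicative
with the `p`-adic tower, the depth datum `(t ≤ ord_p c_p, p^{t+1} ∤ P)`, analytic rank `≤ 1`, `#Ш_an` a
`p`-unit. Class-free binders: `hJ` (K3), `h44`, `hF1`, `hrec`, `hD36`, `hGZK` — NO `hKo`, NO `hMcU`, NO index.
[cite: Jetchev2008, Thm. 1.4, Cor. 1.5 (p. 812)] [cite: Miller2011LMS, Def. 1.1] -/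
theorem bsdp_of_carrierMultCertificate_of_depth
    (hJ : JetchevDivisibilityCarrierMult)
    (h44 : McCallum1991.prop44_localOrder_kolyvaginClass_mul_eq)
    (hF1 : Gross1991_heegnerPoint_sub_ratTorsion_mem_E0)
    (hGZK : rank_eq_analyticRank_of_analyticRank_le_one)
    (W : WeierstrassCurve ℚ) [W.IsElliptic] [W.IsGloballyMinimal] [NeZero (W.conductorNorm ℤ)]
    (K : Type) [Field K] [NumberField K]
    (hrec : heegnerPointOfConductor_one_galoisConj (W.conductorNorm ℤ) W K)
    (hD36 : phi_heegnerTau_mem_singularModuliField (W.conductorNorm ℤ) W K)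
    (hK : IsImaginaryQuadratic K) (hD3 : NumberField.discr K ≠ -3) (hD4 : NumberField.discr K ≠ -4)
    (hH : SatisfiesHeegnerHypothesis (W.conductorNorm ℤ) K)
    (p : ℕ) [Fact p.Prime] (hp2 : p ≠ 2) (hmult : W.HasMultiplicativeReductionAtPrime p)
    (htower : ∀ n : ℕ, W.HasSurjectiveModNGaloisRep (p ^ n : ℕ))
    {P : (W.baseChange K).toAffine.Point} (hP : IsHeegnerPoint (W.conductorNorm ℤ) W K P)
    (hnt : ¬ IsOfFinAddOrder P)
    (t : ℕ) (ht : t ≤ padicValNat p ((W.baseChange ℚ_[p]).localTamagawaNumber ℤ_[p]))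
    (hdepth : ¬ ∃ Q : (W.baseChange K).toAffine.Point, ((p ^ (t + 1) : ℕ) : ℤ) • Q = P)
    (hr : W.analyticRank ≤ 1) {s : ℚ} (hs : shaAn W = (s : ℂ)) (hv : padicValRat p s = 0) :
    BSDp W p :=
  Typed.bsdp_of_shaAn_unit_of_noPTorsion W p hGZK hr hs hv
    (noPTorsion_of_globalDepth_of_depth h44 hF1 W K hrec hD36 hK hD3 hD4 hH p hp2 htower hP hnt t
      (fun Dt β ι d₁ hy₁ s hs' n d hn hℓ ↦
        hJ W (not_hasCM_of_tower W p hp2 htower) K hK hD3 hD4 hH p hp2 hmult htower Dt β ι d₁ hy₁ s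
          (hs'.trans ht) n d hn hℓ) hdepth)

/-- **The bucket-B (multiplicative) JET door on the DEPTH line from NAMED PRINT ONLY, with the register's
galrep datum `ρ̄_{E,p}` onto**: K3 := `jetchevDivisibilityCarrierMult_of_swapLiterature` (road K, McCallum
5.2 struck), [McC] 4.4 := `prop44_of_frobeniusCongruence`, `hrec`/`hD36` := the Literature theorems, the
tower from mod-`p` surjectivity at a multiplicative odd `p` (Tate line). DISPLAYED named print:
{`hPT` (∀ K), `hF1`, `h372`, `hGZK`}. [cite: Jetchev2008, Thm. 1.4, Cor. 1.5 (p. 812)]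
[cite: Wuthrich2014, Lemma 20 (p. 399)] [cite: GrossLMS1991, Prop. 3.7 (2), §10] -/
theorem bsdp_of_carrierMultCertificate_of_swapLiterature_of_depth_of_surj
    (hPT : ∀ (K : Type) [Field K] [NumberField K], poitouTate_selmerStructure_duality_conj K)
    (hF1 : Gross1991_heegnerPoint_sub_ratTorsion_mem_E0)
    (h372 : GrossLMS1991.prop37_2_frobeniusCongruence)
    (hGZK : rank_eq_analyticRank_of_analyticRank_le_one)
    (W : WeierstrassCurve ℚ) [W.IsElliptic] [W.IsGloballyMinimal] [NeZero (W.conductorNorm ℤ)]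
    (K : Type) [Field K] [NumberField K] (hK : IsImaginaryQuadratic K)
    (hD3 : NumberField.discr K ≠ -3) (hD4 : NumberField.discr K ≠ -4)
    (hH : SatisfiesHeegnerHypothesis (W.conductorNorm ℤ) K)
    (p : ℕ) [Fact p.Prime] (hp2 : p ≠ 2) (hmult : W.HasMultiplicativeReductionAtPrime p)
    (hsurj : W.HasSurjectiveModNGaloisRep p)
    {P : (W.baseChange K).toAffine.Point} (hP : IsHeegnerPoint (W.conductorNorm ℤ) W K P)
    (hnt : ¬ IsOfFinAddOrder P)
    (t : ℕ) (ht : t ≤ padicValNat p ((W.baseChange ℚ_[p]).localTamagawaNumber ℤ_[p]))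
    (hdepth : ¬ ∃ Q : (W.baseChange K).toAffine.Point, ((p ^ (t + 1) : ℕ) : ℤ) • Q = P)
    (hr : W.analyticRank ≤ 1) {s : ℚ} (hs : shaAn W = (s : ℂ)) (hv : padicValRat p s = 0) :
    BSDp W p :=
  bsdp_of_carrierMultCertificate_of_depth (jetchevDivisibilityCarrierMult_of_swapLiterature hPT hF1 h372)
    (prop44_of_frobeniusCongruence h372) hF1 hGZK W K
    (heegnerPointOfConductor_one_galoisConj_holds (W.conductorNorm ℤ) W K)
    (phi_heegnerTau_mem_singularModuliField_holds (W.conductorNorm ℤ) W K) hK hD3 hD4 hH p hp2 hmult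
    (fun n ↦ W.forall_hasSurjectiveModNGaloisRep_pow_of_multiplicative_of_surj p hp2 hmult hsurj n) hP hnt
    t ht hdepth hr hs hv

/-! ### §2 Carrier `p` ADDITIVE (K4) on the depth line -/

/-- **`BSD(E,p)` from the bucket-B (additive) certificate on the DEPTH line.** `p` odd, `E` neither good
nor multiplicative at `p`, the `p`-adic tower onto, the depth datum `(t ≤ ord_p c_p, p^{t+1} ∤ P)`, analytic
rank `≤ 1`, `#Ш_an` a `p`-unit. Class-free binders: `hJ` (K4), `h44`, `hF1`, `hrec`, `hD36`, `hGZK` — NO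
`hKo`, NO `hMcU`, NO index. [cite: Jetchev2008, Thm. 1.4, Cor. 1.5 (p. 812)] [cite: Miller2011LMS, Def. 1.1] -/
theorem bsdp_of_carrierAddCertificate_of_depth
    (hJ : JetchevDivisibilityCarrierAdd)
    (h44 : McCallum1991.prop44_localOrder_kolyvaginClass_mul_eq)
    (hF1 : Gross1991_heegnerPoint_sub_ratTorsion_mem_E0)
    (hGZK : rank_eq_analyticRank_of_analyticRank_le_one)
    (W : WeierstrassCurve ℚ) [W.IsElliptic] [W.IsGloballyMinimal] [NeZero (W.conductorNorm ℤ)]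
    (K : Type) [Field K] [NumberField K]
    (hrec : heegnerPointOfConductor_one_galoisConj (W.conductorNorm ℤ) W K)
    (hD36 : phi_heegnerTau_mem_singularModuliField (W.conductorNorm ℤ) W K)
    (hK : IsImaginaryQuadratic K) (hD3 : NumberField.discr K ≠ -3) (hD4 : NumberField.discr K ≠ -4)
    (hH : SatisfiesHeegnerHypothesis (W.conductorNorm ℤ) K)
    (p : ℕ) [Fact p.Prime] (hp2 : p ≠ 2) (hng : ¬ W.HasGoodReductionAtPrime p)
    (hnm : ¬ W.HasMultiplicativeReductionAtPrime p)
    (htower : ∀ n : ℕ, W.HasSurjectiveModNGaloisRep (p ^ n : ℕ))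
    {P : (W.baseChange K).toAffine.Point} (hP : IsHeegnerPoint (W.conductorNorm ℤ) W K P)
    (hnt : ¬ IsOfFinAddOrder P)
    (t : ℕ) (ht : t ≤ padicValNat p ((W.baseChange ℚ_[p]).localTamagawaNumber ℤ_[p]))
    (hdepth : ¬ ∃ Q : (W.baseChange K).toAffine.Point, ((p ^ (t + 1) : ℕ) : ℤ) • Q = P)
    (hr : W.analyticRank ≤ 1) {s : ℚ} (hs : shaAn W = (s : ℂ)) (hv : padicValRat p s = 0) :
    BSDp W p :=
  Typed.bsdp_of_shaAn_unit_of_noPTorsion W p hGZK hr hs hv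
    (noPTorsion_of_globalDepth_of_depth h44 hF1 W K hrec hD36 hK hD3 hD4 hH p hp2 htower hP hnt t
      (fun Dt β ι d₁ hy₁ s hs' n d hn hℓ ↦
        hJ W (not_hasCM_of_tower W p hp2 htower) K hK hD3 hD4 hH p hp2 hng hnm htower Dt β ι d₁ hy₁ s
          (hs'.trans ht) n d hn hℓ) hdepth)

/-- **The bucket-B (additive) JET door on the DEPTH line from NAMED PRINT ONLY** (the tower stays a binder):
K4 := `jetchevDivisibilityCarrierAdd_of_swapLiterature`, [McC] 4.4 := `prop44_of_frobeniusCongruence`,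
`hrec`/`hD36` := the Literature theorems. DISPLAYED named print: {`hPT` (∀ K), `hF1`, `h372`, `hGZK`}.
[cite: Jetchev2008, Thm. 1.4, Cor. 1.5 (p. 812)] [cite: GrossLMS1991, Prop. 3.7 (2), §10] -/
theorem bsdp_of_carrierAddCertificate_of_swapLiterature_of_depth
    (hPT : ∀ (K : Type) [Field K] [NumberField K], poitouTate_selmerStructure_duality_conj K)
    (hF1 : Gross1991_heegnerPoint_sub_ratTorsion_mem_E0)
    (h372 : GrossLMS1991.prop37_2_frobeniusCongruence)
    (hGZK : rank_eq_analyticRank_of_analyticRank_le_one)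
    (W : WeierstrassCurve ℚ) [W.IsElliptic] [W.IsGloballyMinimal] [NeZero (W.conductorNorm ℤ)]
    (K : Type) [Field K] [NumberField K] (hK : IsImaginaryQuadratic K)
    (hD3 : NumberField.discr K ≠ -3) (hD4 : NumberField.discr K ≠ -4)
    (hH : SatisfiesHeegnerHypothesis (W.conductorNorm ℤ) K)
    (p : ℕ) [Fact p.Prime] (hp2 : p ≠ 2) (hng : ¬ W.HasGoodReductionAtPrime p)
    (hnm : ¬ W.HasMultiplicativeReductionAtPrime p)
    (htower : ∀ n : ℕ, W.HasSurjectiveModNGaloisRep (p ^ n : ℕ))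
    {P : (W.baseChange K).toAffine.Point} (hP : IsHeegnerPoint (W.conductorNorm ℤ) W K P)
    (hnt : ¬ IsOfFinAddOrder P)
    (t : ℕ) (ht : t ≤ padicValNat p ((W.baseChange ℚ_[p]).localTamagawaNumber ℤ_[p]))
    (hdepth : ¬ ∃ Q : (W.baseChange K).toAffine.Point, ((p ^ (t + 1) : ℕ) : ℤ) • Q = P)
    (hr : W.analyticRank ≤ 1) {s : ℚ} (hs : shaAn W = (s : ℂ)) (hv : padicValRat p s = 0) :
    BSDp W p :=
  bsdp_of_carrierAddCertificate_of_depth (jetchevDivisibilityCarrierAdd_of_swapLiterature hPT hF1 h372)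
    (prop44_of_frobeniusCongruence h372) hF1 hGZK W K
    (heegnerPointOfConductor_one_galoisConj_holds (W.conductorNorm ℤ) W K)
    (phi_heegnerTau_mem_singularModuliField_holds (W.conductorNorm ℤ) W K) hK hD3 hD4 hH p hp2 hng hnm htower
    hP hnt t ht hdepth hr hs hv

/-! ### §3 LEVEL FORMS (the register quotes a Heegner level `N`; `N = N_E` by Carayol from modularity) -/

/-- **Level form, bucket A** (`K` Heegner for `N`, `P` a Heegner point of level `N`, `q ∣ N`, `q ≠ p`, the
tower at an odd `p`, the depth datum). Displayed named print: {PT, F1, Gross 3.7 (2), GZK, modularity}.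
[cite: Jetchev2008, Cor. 1.5 (p. 812)] [cite: DiamondShurman2005, Thm. 8.8.1] -/
theorem bsdp_of_carrierNeCertificate_level_of_swapLiterature_of_depth
    (hPT : ∀ (K : Type) [Field K] [NumberField K], poitouTate_selmerStructure_duality_conj K)
    (hF1 : Gross1991_heegnerPoint_sub_ratTorsion_mem_E0)
    (h372 : GrossLMS1991.prop37_2_frobeniusCongruence)
    (hGZK : rank_eq_analyticRank_of_analyticRank_le_one) (hmod : exists_isNewformOf)
    (W : WeierstrassCurve ℚ) [W.IsElliptic] [W.IsGloballyMinimal] (p : ℕ) [Fact p.Prime]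
    {N : ℕ} [NeZero N] {K : Type} [Field K] [NumberField K] (hK : IsImaginaryQuadratic K)
    (hD3 : NumberField.discr K ≠ -3) (hD4 : NumberField.discr K ≠ -4)
    (hH : SatisfiesHeegnerHypothesis N K) {P : (W.baseChange K).toAffine.Point}
    (hP : IsHeegnerPoint N W K P) (hnt : ¬ IsOfFinAddOrder P)
    (hp2 : p ≠ 2) (htower : ∀ n : ℕ, W.HasSurjectiveModNGaloisRep (p ^ n : ℕ))
    (q : ℕ) [Fact q.Prime] (hqN : q ∣ N) (hqp : q ≠ p)
    (t : ℕ) (ht : t ≤ padicValNat p ((W.baseChange ℚ_[q]).localTamagawaNumber ℤ_[q]))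
    (hdepth : ¬ ∃ Q : (W.baseChange K).toAffine.Point, ((p ^ (t + 1) : ℕ) : ℤ) • Q = P)
    (hr : W.analyticRank ≤ 1) {s : ℚ} (hs : shaAn W = (s : ℂ)) (hv : padicValRat p s = 0) :
    BSDp W p := by
  obtain ⟨Dt, -, -, -⟩ := id hP
  have hN : N = W.conductorNorm ℤ := IsNewformOf.level_eq_conductorNorm_of_exists_isNewformOf' hmod Dt.isNewformOf
  subst hN
  exact bsdp_of_carrierNeCertificate_of_swapLiterature_of_depth hPT hF1 h372 hGZK W K hK hD3 hD4 hH p hp2 htower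
    hP hnt q hqN hqp t ht hdepth hr hs hv

/-- **Level form, bucket A, `p ≥ 5`** (Serre tower from `ρ̄_{E,p}` onto).
[cite: SerreAbelianLadic1968, Ch. IV §3.4 Lemma 3] [cite: Jetchev2008, Cor. 1.5 (p. 812)] -/
theorem bsdp_of_carrierNeCertificate_level_of_swapLiterature_of_depth_of_five_le
    (hPT : ∀ (K : Type) [Field K] [NumberField K], poitouTate_selmerStructure_duality_conj K)
    (hF1 : Gross1991_heegnerPoint_sub_ratTorsion_mem_E0)
    (h372 : GrossLMS1991.prop37_2_frobeniusCongruence)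
    (hGZK : rank_eq_analyticRank_of_analyticRank_le_one) (hmod : exists_isNewformOf)
    (W : WeierstrassCurve ℚ) [W.IsElliptic] [W.IsGloballyMinimal] (p : ℕ) [Fact p.Prime]
    {N : ℕ} [NeZero N] {K : Type} [Field K] [NumberField K] (hK : IsImaginaryQuadratic K)
    (hD3 : NumberField.discr K ≠ -3) (hD4 : NumberField.discr K ≠ -4)
    (hH : SatisfiesHeegnerHypothesis N K) {P : (W.baseChange K).toAffine.Point}
    (hP : IsHeegnerPoint N W K P) (hnt : ¬ IsOfFinAddOrder P)
    (h5 : 5 ≤ p) (hsurj : W.HasSurjectiveModNGaloisRep p)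
    (q : ℕ) [Fact q.Prime] (hqN : q ∣ N) (hqp : q ≠ p)
    (t : ℕ) (ht : t ≤ padicValNat p ((W.baseChange ℚ_[q]).localTamagawaNumber ℤ_[q]))
    (hdepth : ¬ ∃ Q : (W.baseChange K).toAffine.Point, ((p ^ (t + 1) : ℕ) : ℤ) • Q = P)
    (hr : W.analyticRank ≤ 1) {s : ℚ} (hs : shaAn W = (s : ℂ)) (hv : padicValRat p s = 0) :
    BSDp W p := by
  have hp2 : p ≠ 2 := by omega
  exact bsdp_of_carrierNeCertificate_level_of_swapLiterature_of_depth hPT hF1 h372 hGZK hmod W p hK hD3 hD4 hH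
    hP hnt hp2 (serre_hasSurjectiveModNGaloisRep_pow_holds W p h5 hsurj) q hqN hqp t ht hdepth hr hs hv

/-- **Level form, bucket A, WITNESS datum** (`Q₀ ∈ E(K)`, `p^t • Q₀ = P`, `Q₀ ∉ p·E(K)`; `E(K)[p] = 0` from
the tower). Displayed named print: {PT, F1, Gross 3.7 (2), GZK, modularity}.
[cite: Jetchev2008, Cor. 1.5 (p. 812)] [cite: McCallumLMS1991, §5 Lemma 5.1 (p. 303)] -/
theorem bsdp_of_carrierNeCertificate_level_of_swapLiterature_of_witness
    (hPT : ∀ (K : Type) [Field K] [NumberField K], poitouTate_selmerStructure_duality_conj K)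
    (hF1 : Gross1991_heegnerPoint_sub_ratTorsion_mem_E0)
    (h372 : GrossLMS1991.prop37_2_frobeniusCongruence)
    (hGZK : rank_eq_analyticRank_of_analyticRank_le_one) (hmod : exists_isNewformOf)
    (W : WeierstrassCurve ℚ) [W.IsElliptic] [W.IsGloballyMinimal] (p : ℕ) [Fact p.Prime]
    {N : ℕ} [NeZero N] {K : Type} [Field K] [NumberField K] (hK : IsImaginaryQuadratic K)
    (hD3 : NumberField.discr K ≠ -3) (hD4 : NumberField.discr K ≠ -4)
    (hH : SatisfiesHeegnerHypothesis N K) {P : (W.baseChange K).toAffine.Point}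
    (hP : IsHeegnerPoint N W K P) (hnt : ¬ IsOfFinAddOrder P)
    (hp2 : p ≠ 2) (htower : ∀ n : ℕ, W.HasSurjectiveModNGaloisRep (p ^ n : ℕ))
    (q : ℕ) [Fact q.Prime] (hqN : q ∣ N) (hqp : q ≠ p)
    (t : ℕ) (ht : t ≤ padicValNat p ((W.baseChange ℚ_[q]).localTamagawaNumber ℤ_[q]))
    {Q₀ : (W.baseChange K).toAffine.Point} (hQ₀ : ((p ^ t : ℕ) : ℤ) • Q₀ = P)
    (hsat : ¬ ∃ R : (W.baseChange K).toAffine.Point, (p : ℤ) • R = Q₀)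
    (hr : W.analyticRank ≤ 1) {s : ℚ} (hs : shaAn W = (s : ℂ)) (hv : padicValRat p s = 0) :
    BSDp W p :=
  bsdp_of_carrierNeCertificate_level_of_swapLiterature_of_depth hPT hF1 h372 hGZK hmod W p hK hD3 hD4 hH hP hnt
    hp2 htower q hqN hqp t ht
    (not_exists_pow_succ_smul_eq_of_saturated p hQ₀ hsat (forall_smul_eq_zero_of_tower W K hK p htower))
    hr hs hv

/-- **Level form, carrier `p` multiplicative, `ρ̄_{E,p}` onto.** Displayed named print: {PT, F1, Gross 3.7 (2),
GZK, modularity}. [cite: Jetchev2008, Cor. 1.5 (p. 812)] [cite: DiamondShurman2005, Thm. 8.8.1] -/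
theorem bsdp_of_carrierMultCertificate_level_of_swapLiterature_of_depth_of_surj
    (hPT : ∀ (K : Type) [Field K] [NumberField K], poitouTate_selmerStructure_duality_conj K)
    (hF1 : Gross1991_heegnerPoint_sub_ratTorsion_mem_E0)
    (h372 : GrossLMS1991.prop37_2_frobeniusCongruence)
    (hGZK : rank_eq_analyticRank_of_analyticRank_le_one) (hmod : exists_isNewformOf)
    (W : WeierstrassCurve ℚ) [W.IsElliptic] [W.IsGloballyMinimal] (p : ℕ) [Fact p.Prime]
    {N : ℕ} [NeZero N] {K : Type} [Field K] [NumberField K] (hK : IsImaginaryQuadratic K)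
    (hD3 : NumberField.discr K ≠ -3) (hD4 : NumberField.discr K ≠ -4)
    (hH : SatisfiesHeegnerHypothesis N K) {P : (W.baseChange K).toAffine.Point}
    (hP : IsHeegnerPoint N W K P) (hnt : ¬ IsOfFinAddOrder P)
    (hp2 : p ≠ 2) (hmult : W.HasMultiplicativeReductionAtPrime p) (hsurj : W.HasSurjectiveModNGaloisRep p)
    (t : ℕ) (ht : t ≤ padicValNat p ((W.baseChange ℚ_[p]).localTamagawaNumber ℤ_[p]))
    (hdepth : ¬ ∃ Q : (W.baseChange K).toAffine.Point, ((p ^ (t + 1) : ℕ) : ℤ) • Q = P)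
    (hr : W.analyticRank ≤ 1) {s : ℚ} (hs : shaAn W = (s : ℂ)) (hv : padicValRat p s = 0) :
    BSDp W p := by
  obtain ⟨Dt, -, -, -⟩ := id hP
  have hN : N = W.conductorNorm ℤ := IsNewformOf.level_eq_conductorNorm_of_exists_isNewformOf' hmod Dt.isNewformOf
  subst hN
  exact bsdp_of_carrierMultCertificate_of_swapLiterature_of_depth_of_surj hPT hF1 h372 hGZK W K hK hD3 hD4 hH
    p hp2 hmult hsurj hP hnt t ht hdepth hr hs hv

/-- **Level form, carrier `p` additive.** Displayed named print: {PT, F1, Gross 3.7 (2), GZK, modularity}.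
[cite: Jetchev2008, Cor. 1.5 (p. 812)] [cite: DiamondShurman2005, Thm. 8.8.1] -/
theorem bsdp_of_carrierAddCertificate_level_of_swapLiterature_of_depth
    (hPT : ∀ (K : Type) [Field K] [NumberField K], poitouTate_selmerStructure_duality_conj K)
    (hF1 : Gross1991_heegnerPoint_sub_ratTorsion_mem_E0)
    (h372 : GrossLMS1991.prop37_2_frobeniusCongruence)
    (hGZK : rank_eq_analyticRank_of_analyticRank_le_one) (hmod : exists_isNewformOf)
    (W : WeierstrassCurve ℚ) [W.IsElliptic] [W.IsGloballyMinimal] (p : ℕ) [Fact p.Prime]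
    {N : ℕ} [NeZero N] {K : Type} [Field K] [NumberField K] (hK : IsImaginaryQuadratic K)
    (hD3 : NumberField.discr K ≠ -3) (hD4 : NumberField.discr K ≠ -4)
    (hH : SatisfiesHeegnerHypothesis N K) {P : (W.baseChange K).toAffine.Point}
    (hP : IsHeegnerPoint N W K P) (hnt : ¬ IsOfFinAddOrder P)
    (hp2 : p ≠ 2) (hng : ¬ W.HasGoodReductionAtPrime p) (hnm : ¬ W.HasMultiplicativeReductionAtPrime p)
    (htower : ∀ n : ℕ, W.HasSurjectiveModNGaloisRep (p ^ n : ℕ))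
    (t : ℕ) (ht : t ≤ padicValNat p ((W.baseChange ℚ_[p]).localTamagawaNumber ℤ_[p]))
    (hdepth : ¬ ∃ Q : (W.baseChange K).toAffine.Point, ((p ^ (t + 1) : ℕ) : ℤ) • Q = P)
    (hr : W.analyticRank ≤ 1) {s : ℚ} (hs : shaAn W = (s : ℂ)) (hv : padicValRat p s = 0) :
    BSDp W p := by
  obtain ⟨Dt, -, -, -⟩ := id hP
  have hN : N = W.conductorNorm ℤ := IsNewformOf.level_eq_conductorNorm_of_exists_isNewformOf' hmod Dt.isNewformOf
  subst hN
  exact bsdp_of_carrierAddCertificate_of_swapLiterature_of_depth hPT hF1 h372 hGZK W K hK hD3 hD4 hH p hp2 hng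
    hnm htower hP hnt t ht hdepth hr hs hv

end Summit.BirchSwinnertonDyer.Rank1Residual.JET

end
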